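import Literature.Geometry.Lorentzian.KerrTortoiseFarAsymptotics
import Literature.Geometry.Lorentzian.TeukolskyInfinityNormalisedLimits
import Literature.Geometry.Lorentzian.TeukolskyRadialSchrodingerForm
import Literature.Analysis.ODE.JostOutgoingRemainder
import HarnessLib

/-!
# Quantitative outgoing (Jost) asymptotics of the infinity-normalised scalar Teukolsky solution:
# `‖(r² + a²)^{1/2} R_𝓘(r) − c₀ e^{iωr + 2iMω log r}‖ ≤ 12(1 + Λ)/(|ω| r) + 16M²|ω|/r`, uniformly in `|a| < M`

(namespace `Literature.Geometry.Lorentzian.Kerr`.) Teixeira da Costa (CMP 378 (2020) = arXiv:1910.02854,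
Def. 2.3 / Lemma 2.2) normalises the radial solution at `𝓘⁺` by its outgoing expansion
`R_𝓘 = e^{iωr + 2iMω log r}(c₀ r^{−1} + c₁ r^{−2} + …)`, `|c₀| = 1`; the tree records this as
`Kerr.IsNormalisedInfinitySolution M 0 ω R` — per solution, with UNTRACKED constants in the
`O(r^{−N−2})`. The physical-space summation of the `KappaExplicitWaveDecay` crux (DRSR arXiv:1402.7034 §9,
far sources) needs the first-order remainder QUANTIFIED uniformly in the frequency parameters and in
`|a| < M`. This file proves it for EVERY such solution (no appeal to a constructed one):

* `Costa2019.im_conj_u_mul_tortoiseDeriv` — the `𝓘⁺` flux in the tortoise variable, `Im(ū u′) = ω`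
  (`u = (r² + a²)^{1/2} R`, `u′ = (Δ/(r² + a²)) d/dr[(r² + a²)^{1/2} R]`; from
  `Costa2019.radialFlux_eq_of_normalisedInfinity`);
* `jost_remainder_tortoise` — along any tortoise radius function `ρ` with `ρ X ≥ R_far =
  max(7M, √(12Λ)/|ω|, 1/(Mω²))`: `‖u(x) − A e^{iωx}‖ ≤ 12(1 + Λ)/(|ω| ρ x)` and
  `‖u′(x) − iωA e^{iωx}‖ ≤ 12(1 + Λ)/ρ x` for `x > X`, some `‖A‖ = 1` — the abstract Volterra estimate
  `Literature.Analysis.ODE.jost_outgoing_remainder` (incoming amplitude killed by the end data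
  `‖u‖ → 1`, `‖u′‖ → |ω|`, `Im(ū u′) = ω` of the normalisation) fed with the far sup bound `‖u‖ ≤ 2`
  (`Kerr.carter_far_norm_le_two`) and the `r*`-tail `∫ₓ^∞ |V| ≤ 6(1 + Λ)/ρ x`
  (`IsTortoiseRadius.integral_abs_sepPotential_le`);
* `jost_remainder_le` — the `r`-form with TdC's explicit phase: for
  `r > max(8M, √(12Λ)/|ω|, 1/(Mω²))`,
  `‖(r² + a²)^{1/2} R(r) − c₀ e^{iωr + 2iMω log r}‖ ≤ 12(1 + Λ)/(|ω| r) + 16M²|ω|/r` with `‖c₀‖ = 1`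
  (`ρ = Kerr.tortoiseRadius`, `t̄ ∘ ρ = id`, phase error `Kerr.norm_cexp_starTime_sub_le`).

All constants are absolute or powers of `M`; nothing depends on `a`. Everything is proved; theorems
only. NOT here: derivative asymptotics in the `r`-form, higher-order terms, `s ≠ 0`.

## References
* R. Teixeira da Costa, CMP 378 (2020) 705–781 = arXiv:1910.02854: Def. 2.3 (and footnote),
  Lemma 2.2, Prop. 2.20. [Costa2019]
* M. Dafermos, I. Rodnianski, Y. Shlapentokh-Rothman, arXiv:1402.7034 = Ann. of Math. 183 (2016),
  §5.3 (`u_out ∼ e^{iωr*}`), §8.4, §9. [DafermosRodnianskiShlapentokhrothman2014]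
* P. Hartman, *Ordinary Differential Equations*, SIAM Classics 38 (2002), Ch. XI §9. [Hartman2002]
-/

noncomputable section

open Complex Set Filter MeasureTheory
open scoped _root_.Topology ComplexConjugate

namespace Literature.Geometry.Lorentzian.Kerr

/-! ### The `u`-flux of the infinity-normalised solution: `Im(ū u′) = ω` -/

/-- `d/ds (s² + a²)^{1/2} = s/(s² + a²)^{1/2}` where `s² + a² > 0`. [folklore] -/
private theorem hasDerivAt_sqrt_sq_add_sq_far {a y : ℝ} (hy : 0 < y ^ 2 + a ^ 2) :
    HasDerivAt (fun s : ℝ => Real.sqrt (s ^ 2 + a ^ 2)) (y / Real.sqrt (y ^ 2 + a ^ 2)) y := by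
  have h1 : HasDerivAt (fun s : ℝ => s ^ 2 + a ^ 2) (2 * y) y := by
    simpa using (hasDerivAt_pow 2 y).add_const (a ^ 2)
  refine (h1.sqrt hy.ne').congr_deriv ?_
  rw [mul_div_mul_left _ _ (two_ne_zero' ℝ)]

namespace Costa2019

/-- **`Im(ū_𝓘 u_𝓘′) = ω` in the tortoise variable** (`s = 0`, `0 < M`, `|a| < M`, `ω ≠ 0`): for a
classical radial solution `R` normalised at `𝓘⁺` and `r > r₊`, with `u = (r² + a²)^{1/2} R` and
`u′ = (Δ/(r² + a²))·d/dr[(r² + a²)^{1/2} R]` (the `r*`-derivative, `Kerr.schrodingerForm`),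
`Im(conj(u(r))·u′(r)) = Δ·Im(R̄ R′) = ω` — the `𝓘⁺` flux `Costa2019.radialFlux_eq_of_normalisedInfinity`
rewritten for `u` (the `S′`-term `Δ r |R|²/(r² + a²)` is real). [cite: Costa2019, Proposition 2.20] -/
theorem im_conj_u_mul_tortoiseDeriv {M a ω m lam : ℝ} (hM : 0 < M) (ha : |a| < M) (hω : ω ≠ 0)
    {R : ℝ → ℂ} (hR : IsRadialTeukolskySolution M a 0 ω m lam R)
    (hn : IsNormalisedInfinitySolution M 0 ω R) {r : ℝ} (hr : rPlus M a < r) :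
    (conj (((Real.sqrt (r ^ 2 + a ^ 2) : ℝ) : ℂ) * R r) *
        (((delta M a r / (r ^ 2 + a ^ 2) : ℝ) : ℂ) *
          deriv (fun s : ℝ ↦ ((Real.sqrt (s ^ 2 + a ^ 2) : ℝ) : ℂ) * R s) r)).im = ω := by
  have hflux := radialFlux_eq_of_normalisedInfinity hM ha hω hR hn hr
  obtain ⟨hd1, -, -, -⟩ := deriv_facts_of_isRadialTeukolskySolution ha.le hR
  have hr0 : 0 < r := (rPlus_pos hM a).trans hr
  have hA : 0 < r ^ 2 + a ^ 2 := by positivity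
  have hS : 0 < Real.sqrt (r ^ 2 + a ^ 2) := Real.sqrt_pos.2 hA
  have hS2 : Real.sqrt (r ^ 2 + a ^ 2) ^ 2 = r ^ 2 + a ^ 2 := Real.sq_sqrt hA.le
  have hD : HasDerivAt (fun s : ℝ => ((Real.sqrt (s ^ 2 + a ^ 2) : ℝ) : ℂ) * R s)
      (((r / Real.sqrt (r ^ 2 + a ^ 2) : ℝ) : ℂ) * R r +
        ((Real.sqrt (r ^ 2 + a ^ 2) : ℝ) : ℂ) * deriv R r) r :=
    (hasDerivAt_sqrt_sq_add_sq_far hA).ofReal_comp.fun_mul (hd1 r hr)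
  rw [hD.deriv]
  -- `conj(S R)·(D·((r/S) R + S R′)) = (D r)·|R|² + (D S²)·(R̄ R′)`, and `D S² = Δ`
  have e : conj (((Real.sqrt (r ^ 2 + a ^ 2) : ℝ) : ℂ) * R r) *
      (((delta M a r / (r ^ 2 + a ^ 2) : ℝ) : ℂ) *
        (((r / Real.sqrt (r ^ 2 + a ^ 2) : ℝ) : ℂ) * R r +
          ((Real.sqrt (r ^ 2 + a ^ 2) : ℝ) : ℂ) * deriv R r)) =
      ((delta M a r / (r ^ 2 + a ^ 2) * r : ℝ) : ℂ) * (‖R r‖ : ℂ) ^ 2 +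
        ((delta M a r : ℝ) : ℂ) * (conj (R r) * deriv R r) := by
    set Dc : ℂ := ((delta M a r / (r ^ 2 + a ^ 2) : ℝ) : ℂ) with hDc
    set Sc : ℂ := ((Real.sqrt (r ^ 2 + a ^ 2) : ℝ) : ℂ) with hSc
    have hSc0 : Sc ≠ 0 := by rw [hSc]; exact_mod_cast hS.ne'
    have key : Dc * Sc ^ 2 = (delta M a r : ℂ) := by
      rw [hDc, hSc, ← Complex.ofReal_pow, ← Complex.ofReal_mul, hS2, div_mul_cancel₀ _ hA.ne']
    have hcS : conj Sc = Sc := by rw [hSc]; exact Complex.conj_ofReal _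
    rw [← Complex.mul_conj', Complex.ofReal_mul, Complex.ofReal_div r, ← hDc, ← hSc, ← key]
    simp only [map_mul, hcS]
    field_simp
  rw [e, Complex.add_im, ← Complex.ofReal_pow, ← Complex.ofReal_mul, Complex.ofReal_im, zero_add,
    Complex.im_ofReal_mul, hflux]

end Costa2019

/-! ### The Jost remainder of the infinity-normalised solution -/

section Jost

variable {M a ω Λ : ℝ} {m : ℤ} {R : ℝ → ℂ} {ρ : ℝ → ℝ}

/-- **Quantitative Jost asymptotics of `u_𝓘` in the tortoise variable.** Let `0 < M`, `|a| < M`,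
`ω ≠ 0`, `(ω, m, Λ)` admissible, `R` a classical solution of the scalar radial Teukolsky ODE
(`λ = Λ − a²ω²`) normalised at `𝓘⁺` (TdC Def. 2.3), `ρ` a tortoise radius function and `X` with
`ρ X ≥ R_far := max(7M, √(12Λ)/|ω|, 1/(Mω²))`. Then there is `A`, `‖A‖ = 1`, with for all `x > X`
(`u = (ρ² + a²)^{1/2} R ∘ ρ`, `u′ = (Δ/(r² + a²))·d/dr[(r² + a²)^{1/2}R] ∘ ρ`):
`‖u(x) − A e^{iωx}‖ ≤ 12(1 + Λ)/(|ω| ρ x)` and `‖u′(x) − iωA e^{iωx}‖ ≤ 12(1 + Λ)/ρ x` — the Volterra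
remainder `(B/|ω|)∫ₓ^∞ |V| dr*` of `Literature.Analysis.ODE.jost_outgoing_remainder` with the far sup
bound `B = 2` (`Kerr.carter_far_norm_le_two`) and the tail `∫ₓ^∞ |V| dr* ≤ 6(1 + Λ)/ρ x`
(`IsTortoiseRadius.integral_abs_sepPotential_le`); the end data `‖u‖ → 1`, `‖u′‖ → |ω|`, `Im(ū u′) = ω`
are those of the normalisation (`Costa2019.tendsto_norm_infinitySolution`,
`Costa2019.tendsto_norm_deriv_infinitySolution`, `Costa2019.im_conj_u_mul_tortoiseDeriv`). TdC Lemma 2.2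
/ DRSR §5.3 ("`u_out ∼ e^{iωr*}`") with the constants tracked, uniformly in `|a| < M`.
[cite: Costa2019, Lemma 2.2] -/
theorem jost_remainder_tortoise (hM : 0 < M) (hMa : IsSubextremal M a) (hω : ω ≠ 0)
    (hadm : IsAdmissibleTriple a ω m Λ) (hR : IsRadialTeukolskySolution M a 0 ω m (Λ - a ^ 2 * ω ^ 2) R)
    (hn : IsNormalisedInfinitySolution M 0 ω R) (hρ : IsTortoiseRadius M a ρ) {X : ℝ}
    (hX : max (7 * M) (max (Real.sqrt (12 * Λ) / |ω|) (1 / (M * ω ^ 2))) ≤ ρ X) :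
    ∃ A : ℂ, ‖A‖ = 1 ∧ ∀ x, X < x →
      ‖((Real.sqrt (ρ x ^ 2 + a ^ 2) : ℝ) : ℂ) * R (ρ x) - A * Complex.exp (I * ω * x)‖ ≤
          12 * (1 + Λ) / (|ω| * ρ x) ∧
      ‖((delta M a (ρ x) / (ρ x ^ 2 + a ^ 2) : ℝ) : ℂ) *
            deriv (fun r : ℝ ↦ ((Real.sqrt (r ^ 2 + a ^ 2) : ℝ) : ℂ) * R r) (ρ x) -
          I * ω * A * Complex.exp (I * ω * x)‖ ≤ 12 * (1 + Λ) / ρ x := by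
  have ha : |a| < M := hMa
  obtain ⟨u₁, u₂, hu⟩ := schrodingerForm hM ha hR hρ
  set u : ℝ → ℂ := fun y ↦ ((Real.sqrt (ρ y ^ 2 + a ^ 2) : ℝ) : ℂ) * R (ρ y) with hu_def
  set V : ℝ → ℝ := fun y ↦ sepPotential M a ω m Λ (ρ y) with hV_def
  -- the ODE in the format of the ODE library
  have hode : ∀ x, HasDerivAt u (u₁ x) x ∧
      HasDerivAt u₁ (-(((ω ^ 2 - V x : ℝ) : ℂ) * u x)) x := fun x ↦ by
    obtain ⟨h1, h2, h3, -⟩ := hu x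
    exact ⟨h1, h2.congr_deriv (eq_neg_of_add_eq_zero_left h3)⟩
  have hu₁ : ∀ x, u₁ x = ((delta M a (ρ x) / (ρ x ^ 2 + a ^ 2) : ℝ) : ℂ) *
      deriv (fun r : ℝ ↦ ((Real.sqrt (r ^ 2 + a ^ 2) : ℝ) : ℂ) * R r) (ρ x) := fun x ↦ (hu x).2.2.2
  -- end data at `+∞`
  have hlim : Tendsto (fun x ↦ ‖u x‖) atTop (𝓝 1) := by
    have h := (Costa2019.tendsto_norm_infinitySolution (a := a) hn).comp hρ.tendsto_atTop
    refine h.congr fun x ↦ ?_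
    simp only [Function.comp, hu_def, norm_mul, Complex.norm_real, Real.norm_eq_abs,
      abs_of_nonneg (Real.sqrt_nonneg _)]
  have hlim₁ : Tendsto (fun x ↦ ‖u₁ x‖) atTop (𝓝 |ω|) := by
    have h := (Costa2019.tendsto_norm_deriv_infinitySolution hM ha hω hR hn).comp hρ.tendsto_atTop
    refine h.congr fun x ↦ ?_
    simp only [Function.comp, hu₁ x, norm_mul, Complex.norm_real, Real.norm_eq_abs,
      abs_of_pos (hρ.deriv_pos hMa x)]
  have hflux : ∀ x, X < x → (conj (u x) * u₁ x).im = ω := fun x _ ↦ by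
    rw [hu₁ x]
    exact Costa2019.im_conj_u_mul_tortoiseDeriv hM ha hω hR hn (hρ.rPlus_lt x)
  -- far sup bound `‖u‖ ≤ 2` beyond `X`
  have hB : ∀ x, X < x → ‖u x‖ ≤ 2 := fun x hx ↦
    carter_far_norm_le_two hρ hMa hω hadm hode hlim hlim₁
      (hX.trans ((hρ.strictMono hMa).monotone hx.le))
  -- the potential along `r*`: continuous, integrable beyond `X` (`ρ X ≥ 7M ≥ 4M`)
  have h4X : 4 * M ≤ ρ X := by linarith [le_of_max_le_left hX]
  have hVc : Continuous V := hρ.continuous_sepPotential_comp hMa ω m Λ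
  have hVi : IntegrableOn V (Ioi X) := (hρ.integral_abs_sepPotential_le hMa hadm h4X).1
  obtain ⟨A, hA, hJ⟩ := Literature.Analysis.ODE.jost_outgoing_remainder hω hode hVc hVi hB hlim hlim₁ hflux
  refine ⟨A, hA, fun x hx ↦ ?_⟩
  have h4 : 4 * M ≤ ρ x := h4X.trans ((hρ.strictMono hMa).monotone hx.le)
  have htail := (hρ.integral_abs_sepPotential_le hMa hadm h4).2
  have hρ0 : 0 < ρ x := hρ.pos hMa x
  have hω0 : 0 < |ω| := abs_pos.2 hω
  obtain ⟨hJ1, hJ2⟩ := hJ x hx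
  constructor
  · calc ‖((Real.sqrt (ρ x ^ 2 + a ^ 2) : ℝ) : ℂ) * R (ρ x) - A * Complex.exp (I * ω * x)‖
        ≤ 2 / |ω| * ∫ t in Ioi x, |V t| := hJ1
      _ ≤ 2 / |ω| * (6 * (1 + Λ) / ρ x) := mul_le_mul_of_nonneg_left htail (by positivity)
      _ = 12 * (1 + Λ) / (|ω| * ρ x) := by field_simp; ring
  · rw [← hu₁ x]
    calc ‖u₁ x - I * ω * A * Complex.exp (I * ω * x)‖ ≤ 2 * ∫ t in Ioi x, |V t| := hJ2
      _ ≤ 2 * (6 * (1 + Λ) / ρ x) := mul_le_mul_of_nonneg_left htail zero_le_two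
      _ = 12 * (1 + Λ) / ρ x := by ring

/-- **Quantitative outgoing asymptotics of `u_𝓘` with the explicit phase `ωr + 2Mω log r`.** Let
`0 < M`, `|a| < M`, `ω ≠ 0`, `(ω, m, Λ)` admissible, and `R` a classical solution of the scalar radial
Teukolsky ODE (`λ = Λ − a²ω²`) normalised at `𝓘⁺` (TdC Def. 2.3). Then there is a unimodular `c₀`
with, for every `r > max(8M, √(12Λ)/|ω|, 1/(Mω²))`,
`‖(r² + a²)^{1/2} R(r) − c₀ e^{iωr + 2iMω log r}‖ ≤ 12(1 + Λ)/(|ω| r) + 16M²|ω|/r` — the Jost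
remainder of `jost_remainder_tortoise` along `ρ = Kerr.tortoiseRadius` (`t̄ ∘ ρ = id`) plus the phase
error `|ω|·|t̄(r) − r − 2M log r| ≤ 16M²|ω|/r` (`Kerr.norm_cexp_starTime_sub_le`). The constants are
UNIFORM in `|a| < M`; `c₀` is the unimodular constant of this solution. [cite: Costa2019, Lemma 2.2] -/
theorem jost_remainder_le (hM : 0 < M) (hMa : IsSubextremal M a) (hω : ω ≠ 0)
    (hadm : IsAdmissibleTriple a ω m Λ) (hR : IsRadialTeukolskySolution M a 0 ω m (Λ - a ^ 2 * ω ^ 2) R)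
    (hn : IsNormalisedInfinitySolution M 0 ω R) :
    ∃ c₀ : ℂ, ‖c₀‖ = 1 ∧ ∀ r : ℝ, max (8 * M) (max (Real.sqrt (12 * Λ) / |ω|) (1 / (M * ω ^ 2))) < r →
      ‖((Real.sqrt (r ^ 2 + a ^ 2) : ℝ) : ℂ) * R r -
          c₀ * Complex.exp (I * ω * r + 2 * I * M * ω * Real.log r)‖ ≤
        12 * (1 + Λ) / (|ω| * r) + 16 * M ^ 2 * |ω| / r := by
  set ρ := tortoiseRadius hMa with hρ_def
  have hρ : IsTortoiseRadius M a ρ := isTortoiseRadius_tortoiseRadius hMa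
  set R₇ : ℝ := max (7 * M) (max (Real.sqrt (12 * Λ) / |ω|) (1 / (M * ω ^ 2))) with hR₇
  have hrp2 : rPlus M a ≤ 2 * M := rPlus_le_two_mul_self hM.le a
  have hR₇p : rPlus M a < R₇ := by
    have : 7 * M ≤ R₇ := le_max_left _ _
    linarith
  set X : ℝ := starTime M a R₇ with hX
  have hρX : ρ X = R₇ := tortoiseRadius_starTime hMa hR₇p
  obtain ⟨A, hA, hJ⟩ := jost_remainder_tortoise hM hMa hω hadm hR hn hρ (X := X) (by rw [hρX])
  refine ⟨A, hA, fun r hr ↦ ?_⟩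
  have h8 : 8 * M < r := lt_of_le_of_lt (le_max_left _ _) hr
  have hR₇r : R₇ < r := by
    refine max_lt (by linarith) (lt_of_le_of_lt (le_max_right _ _) hr)
  have hrp : rPlus M a < r := hR₇p.trans hR₇r
  have hr0 : 0 < r := (rPlus_pos hM a).trans hrp
  set x : ℝ := starTime M a r with hx
  have hρx : ρ x = r := tortoiseRadius_starTime hMa hrp
  have hXx : X < x := by
    rw [← hρ.lt_iff_lt hMa, hρX, hρx]; exact hR₇r
  obtain ⟨hJ1, -⟩ := hJ x hXx
  rw [hρx] at hJ1
  have hph := norm_cexp_starTime_sub_le hMa ω h8.le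
  rw [← hx] at hph
  calc ‖((Real.sqrt (r ^ 2 + a ^ 2) : ℝ) : ℂ) * R r -
        A * Complex.exp (I * ω * r + 2 * I * M * ω * Real.log r)‖
      ≤ ‖((Real.sqrt (r ^ 2 + a ^ 2) : ℝ) : ℂ) * R r - A * Complex.exp (I * ω * x)‖ +
          ‖A * Complex.exp (I * ω * x) - A * Complex.exp (I * ω * r + 2 * I * M * ω * Real.log r)‖ :=
        norm_sub_le_norm_sub_add_norm_sub _ _ _
    _ ≤ 12 * (1 + Λ) / (|ω| * r) + 16 * M ^ 2 * |ω| / r := by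
        refine add_le_add hJ1 ?_
        rw [← mul_sub, norm_mul, hA, one_mul]
        exact hph

end Jost

end Literature.Geometry.Lorentzian.Kerr

end
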